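import Summits.BirchSwinnertonDyer.Rank1Residual.Additive.KatoDescentRankOnePerrinRiou
import HarnessLib

/-!
# The Kato descent WITHOUT (12.5.2) at a TORSION-FREE member, part (a): the image-free READINGS
# (rank `0` count 1♭, rank-one count 1″♭, ratio 4♭, realizability-under-KMC 3♭), their consistency with
# parts 1/5 on the (12.5.2) rows, and the `#Ш_an` bookkeeping with `p ∤ #W(ℚ)_tors` in place of `Irr`
# (cell `bsd-potss`, seat `kmc`, generation 3; part 8a of the descent files; consumer: part 8b
# `KatoDescentTorsionFree.lean` and part 9 `O6/X3WildOfKMCOfReadings.lean`)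

HONEST FRAMING (cell `bsd-potss`, `run/shared/lean/pub/bsd-potss/`, FULL-BSD rank-`≤ 1` programme
tranche 1b, row B5 = O6 wild `3` incl. its X3 half (18 852 S-b pairs), rows B4/B8; typed against the
class shells of cell `b2b-bsdres` — `O6/O6Targets.lean` (`O6.X3WildOfKMC`), `O6/X3KatoMemberBound.lean`):
NOTHING about Kato's Main Conjecture or Perrin-Riou's conjecture is asserted and no Literature fact is
minted. As in parts 1–7 (`KatoDescentDatum`, `KMCTrivialDescentRankZero`, `KatoDescentRankOnePerrinRiou`,
`KMCPerrinRiouDescentRankOne`, …) Kato's objects enter through the INTERFACE `KatoDescentDatum p` /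
`IsOf` / `PRRatio` / `KMC`, the printed theorems about them as hypothesis SCHEMATA with locators (§1),
and the conjectures as the interface `KMC` and the named node `PerrinRiouUpToUnitAt`. Census numbers
are not inputs; nothing is booked; no mark of `RESIDUAL-MAP.md` moves; X3 ∧ O6 stays OPEN.

## Why parts 1–7 carried (12.5.2), and what replaces it (memo v3 §X3 of `HOME/bsd-potss-kmc/`)

Parts 1–7 display Kato's (12.5.2) (`ρ_{E,p^∞}(G_{ℚ(ζ_{p^∞})}) ⊇ SL₂(ℤ_p)`) because it is used THREE
times in the printed derivation: (i) Thm. 12.5 (4): `z_γ ∈ 𝐇¹(T)` (integrality) and the divisibility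
`char 𝐇² ∣ char 𝐇¹/z`; (ii) `E(ℚ)[p] = 0`, which makes the two `H⁰` factors of Prop. 14.16's display
trivial and the torsion term of `#Ш_an` prime to `p`; (iii) `E(ℚ)[p^∞] = 0` in Greenberg's Prop. 4.13
(Cassels), which makes `[S(T) : Sel(T)] = ∏_{ℓ≠p} c_ℓ^{(p)}` EXACT (Lemma T). For the direction
**KMC ⇒ BSD_p** NONE of the three needs the image hypothesis — only `p ∤ #W(ℚ)_tors` (`t_W = 0`):
* (i′) Conj. 12.10 ITSELF asserts `Z(f,T)_𝔮 ⊂ 𝐇¹(T)_𝔮` at every height-one `𝔮` (Kato p. 224: "Then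
  `Z(f,T)_𝔭 ⊂ 𝐇¹(T)_𝔭` and `length 𝐇²(T)_𝔭 = length (𝐇¹(T)_𝔭/Z(f,T)_𝔭)`"), i.e. `z_γ` lies in the
  reflexive hull `∩_𝔮 𝐇¹(T)⁰_𝔮` of the torsion-free (Thm. 12.4 (2)) rank-one `Λ⁰`-module `𝐇¹(T)⁰`
  (Bourbaki AC VII §4 no. 2). When `t_W = 0` that module is FREE, hence reflexive: by (14.14.1)
  `𝐇¹(T)⁰/T𝐇¹(T)⁰ ↪ H¹(ℤ[1/p],T)`, whose torsion subgroup injects into `W(ℚ)[p^∞] = 0` (from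
  `0 → T → V → W[p^∞] → 0` over `G_ℚ`; Kato 8.2: `H^q(ℤ[1/p], ·)` is `j_*`-étale cohomology, and
  `H¹(ℤ[1/p], j_*T) ⊂ H¹(ℚ, T)`), so `𝐇¹(T)⁰/T` is `ℤ_p`-torsion-free, and a finitely generated torsion-free
  module `M` over the two-dimensional regular local ring `ℤ_p⟦T⟧` with `M/TM` torsion-free is free
  (`M ↪ M^{**}` free with finite cokernel `Q`; `Q[T] ↪ M/TM` forces `Q = 0`). So under KMC and `t_W = 0`
  Kato's §14.14 data IS a `KatoDescentDatum` with `z = (z_γ)⁰ ∈ 𝐇¹(T)⁰` — READING 3♭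
  `TorsionFree.RealizableOfKMC`. The divisibility half of 12.5 (4) is NOT available without (12.5.2)
  and is NOT used: only the direction KMC ⇒ BSD_p is proved here (no converse).
* (ii′) Prop. 14.16's display `#S(T) = μ⁻¹·ν·#H⁰(ℚ,T⊗ℚ/ℤ)·#H⁰(ℚ,T*(1)⊗ℚ/ℤ)` (p. 244) carries NO
  image hypothesis ("Let `T` be a Gal(ℚ̄/ℚ)-stable `O_λ`-lattice"), and at `t_W = 0` both `H⁰` factors
  are `#W(ℚ)[p^∞] = 1` (referee g7 read p. 244 verbatim: the display is image-free).
* (iii′) Greenberg Prop. 4.13: `coker γ ≅ E(ℚ)[p^∞]^∧ = 0` at `t_W = 0`, so Lemma T is exact.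
The local index `exp*_ω H¹(ℚ_p,T) = c_p·p^{−τ}ℤ_p` (C.-H. Kim AJM 2026 §3.2.3) and the period reading
(Kato Thm. 12.5 (1) normalised as in Prop. 14.21/14.22 through the isomorphism of realisations
`h¹(W) ≅ M(f)` of the member `W` ITSELF — `γ_W` a generator of `H¹(W(ℂ),ℤ)^+`, `ω_W` its Néron
differential; no Manin constant, no isogeny degree: the tree's `…_maninFree` reading of
`Kato2004/AdditivePotGoodRankZeroShaUpperBound.lean`) are image-free and member-free. Hence READING
1♭ / 1″♭ below = parts 1/5's Readings 1/1″ with the binder `Kato2004.ImageContainsSL2 W p` REPLACED by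
`¬ p ∣ W.torsionOrder` and the zeta-index defect kept as the pair (`[A : z]`, `#H²`) instead of an
exponent `m ≥ 0` (which was Thm. 14.5 (3), i.e. (12.5.2) again). On (12.5.2) rows the new schemata are
IMPLIED by the old ones (§2).

## Contents (§1–§3; the descent itself is part 8b)

* §1 the four image-free READINGS (hypothesis schemata over `IsOf` / `PRRatio` / `KMC`; nothing asserted).
* §2 CONSISTENCY: on the (12.5.2) rows each new schema's conclusion follows from parts 1/3/5's
  (`Additive.DescentCountReading`, `Additive.Realizable`, `Additive.RankOneCountReading`) — the new
  schemata are the `m`-free / `p ∤ #tors` rewrites of the old ones, not new claims there.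
* §3 bookkeeping `L^{(r)}(W,1)/(r!·Ω·Reg) ↔ #Ш_an` with `p ∤ #W(ℚ)_tors` as the hypothesis (parts 1/5
  took `Irr W p` and derived `p ∤ #tors` from it).

WHAT THIS IS NOT. Not a proof of KMC or PR^× anywhere; no converse BSD_p ⇒ KMC off (12.5.2) (that needs
the divisibility of Thm. 12.5 (4), replaced in the reducible case by o6-r1's theorem-candidate T-X3K
`O6.KatoMemberShaBoundOfReducible`, not used here); no construction of `𝐇^q(T)`, `z_γ`, `ℒ` (interfaces;
D-O6-2 stands); nothing at `p = 2`, nothing at a potentially multiplicative `p`; no claim at members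
with `p ∣ #W(ℚ)_tors` except through an isogeny to a torsion-free member; nothing is booked.

References: K. Kato, Astérisque 295 (2004): 8.2 (pp. 180–181), Thm. 12.4 (2) (p. 221), Thm. 12.5 (1)
and (4), (12.5.2) (pp. 221–222), Thm. 12.6 (p. 222), Conj. 12.10 (p. 224), 13.8 (pp. 227–228), Thm.
14.5 (pp. 236–237), §14.8 (p. 238), (14.9.3)–(14.9.4) (p. 240), §14.13–14.14, (14.14.1)–(14.14.2),
Lemma 14.15 (pp. 242–244), Prop. 14.16 (2) and its proof (pp. 244–245), Prop. 14.21–14.22 (pp. 248–249)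
[Kato2004Asterisque]; D. Burns, M. Kurihara, T. Sano, JMSJ 76 (2024) = arXiv:1910.07404, Hyp. 2.2 and
Remark 2.3 (p. 9), Conj. 1.5, Thm. 7.3, Thm. 7.6, Remark 7.7 (p. 29) [BurnsKuriharaSano2019];
R. Greenberg, LNM 1716 (1999) Prop. 4.13 and §3 [GreenbergLNM1716]; J. Coates, LNM 1716 (1999) Lemma
3.6, 3.8 [CoatesLNM1716]; C.-H. Kim, AJM 148 (2026) §3.2.3 [Kim2022StructureSelmer]; N. Bourbaki,
*Algèbre commutative* VII §4 no. 2 (reflexive hull = intersection of the localisations at height one)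
[BourbakiAC5to7]; J. W. S. Cassels, J. reine angew. Math. 217 (1965) [Cassels1965ArithmeticVIII];
R. L. Miller, LMS JCM 14 (2011) Def. 1.1 [Miller2011LMS].
-/

set_option autoImplicit false

noncomputable section

open scoped Classical

open WeierstrassCurve Literature.NumberTheory.EllipticCurves
  Literature.NumberTheory.EllipticCurves.ModularForms
  Literature.NumberTheory.EllipticCurves.Rank1Residual
  Literature.NumberTheory.EllipticCurves.Rank1Residual.Typed
  Literature.NumberTheory.EllipticCurves.IwasawaAlgebra

namespace Summit.BirchSwinnertonDyer.Rank1Residual.Additive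

namespace TorsionFree

/-! ## §1 The readings at a torsion-free member (hypothesis schemata; NO image hypothesis; nothing asserted) -/

section Readings

variable (IsOf : ∀ (W : WeierstrassCurve ℚ) [W.IsElliptic] [W.IsGloballyMinimal] (p : ℕ) [Fact p.Prime],
  KatoDescentDatum p → Prop)
variable (PRRatio : ∀ (W : WeierstrassCurve ℚ) [W.IsElliptic] [W.IsGloballyMinimal] (p : ℕ)
  [Fact p.Prime], ℚ_[p] → Prop)
variable (KMC : ∀ (W : WeierstrassCurve ℚ) [W.IsElliptic] [W.IsGloballyMinimal] (p : ℕ), Prop)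

/-- **READING 1♭ — the rank-`0` Poitou–Tate count over a realised Kato descent datum at a TORSION-FREE
member, image-free.** For `W/ℚ` globally minimal, `p ≠ 2` additive and potentially good,
`p ∤ #W(ℚ)_tors`, `L(E,1) ≠ 0`, `Ш(E)` finite and a realised datum `D`: `H²(ℤ[1/p],T)` is finite
(Thm. 14.5 (1), proved in 14.13 from Thm. 12.5 (3) — no image hypothesis, CM included via §15), and
with `L(E,1)/Ω(W) = q ∈ ℚ`:
**`ord_p #Ш(E)(p) + v_p(Tam E) + v_p [H¹(ℤ[1/p],T) : z] = ord_p q + v_p #H²(ℤ[1/p],T)`** — Prop.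
14.16's display `#S(T) = μ⁻¹ν·#H⁰·#H⁰` (p. 244; any stable lattice `T`; both `H⁰ = W(ℚ)[p^∞] = 1`
here), `#S(T) = #Ш[p^∞]·∏_{ℓ≠p} c_ℓ^{(p)}` (Lemma T: §14.8 + Greenberg Prop. 4.13 with
`E(ℚ)[p^∞] = 0` + §3), `ν = p^{ord_p(L/Ω) − v_p(c_p)}` (local index `exp*_ω H¹(ℚ_p,T) = c_p·p^{−τ}ℤ_p`,
Kim §3.2.3; period via the realisation isomorphism of `W` itself, Prop. 14.21/14.22 normalisation, no
Manin constant). = part 1's `DescentCountReading` with `Kato2004.ImageContainsSL2 W p` REPLACED by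
`¬ p ∣ W.torsionOrder` and the defect `μ = [A : z]/#H²` kept as a pair instead of `p^m`, `m ≥ 0`
(Thm. 14.5 (3) needs (12.5.2); NOT claimed here). Hypothesis schema; nothing asserted.
[cite: Kato2004Asterisque, Prop. 14.16 (2) and proof (pp. 244–245), Thm. 14.5 (1) (p. 236), §14.13 (p. 242), §14.8 (p. 238), Prop. 14.21–14.22 (pp. 248–249)]
[cite: GreenbergLNM1716, Prop. 4.13 and §3 after Lemma 3.3] [cite: Kim2022StructureSelmer, §3.2.3 display before Thm. 3.7 (PDF p. 16)] -/
def DescentCountReading : Prop :=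
  ∀ (W : WeierstrassCurve ℚ) [W.IsElliptic] [W.IsGloballyMinimal] (p : ℕ) [Fact p.Prime]
    (D : KatoDescentDatum p),
    p ≠ 2 → Addv W p → 0 ≤ padicValRat p W.j → ¬ p ∣ W.torsionOrder →
    W.entireLFunction 1 ≠ 0 → Finite W.sha → IsOf W p D →
    Finite (coinvariants p D.H2) ∧
      ∃ q : ℚ, W.entireLFunction 1 / (W.realPeriodRat : ℂ) = (q : ℂ) ∧
        (padicValNat p (Nat.card (AddCommGroup.primaryComponent W.sha p)) : ℤ) +
            padicValNat p W.tamagawaProduct + padicValNat p D.zetaIndex =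
          padicValRat p q + padicValNat p D.h2Card

/-- **READING 1″♭ — the rank-ONE count through the Perrin-Riou ratio at a TORSION-FREE member,
image-free** (= part 5's `RankOneCountReading` with `Kato2004.ImageContainsSL2 W p` REPLACED by
`¬ p ∣ W.torsionOrder`): for `W/ℚ` globally minimal of analytic rank `1`, `p ≠ 2` additive
potentially good, `p ∤ #W(ℚ)_tors`, `Ш(E)` finite, a realised datum `D` and the ratio `ℒ` of its zeta
element: `H²(ℤ[1/p],T)` finite; `ℒ ≠ 0 ⟺ [H¹(ℤ[1/p],T) : z] ≠ 0` (`H¹(ℤ[1/p],T) ≅ ℤ_p` is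
TORSION-FREE because its torsion injects into `W(ℚ)[p^∞] = 0` — Burns–Kurihara–Sano Hyp. 2.2 (i),
which their Remark 2.3 derives from irreducibility but which needs only `t_W = 0`); and WHENEVER
`[H¹(ℤ[1/p],T) : z] = p^m·#H²(ℤ[1/p],T)`, **`v_p(ℒ) = m + ord_p #Ш(E)[p^∞] + ord_p Tam(E)`** (memo v2
§4 R1-a…R1-g with `p ∤ #tors` as the only use of the image hypothesis; `m = 0` = BKS Thm. 7.3 / 7.8 (d)
in Kato's normalisation). `PRRatio W p ℒ` is read as in part 5's module docstring MINUS its (12.5.2)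
clause (which there only served `z ∈ H¹(ℤ[1/p],T)`): `ℒ = log_ω(loc_p z)/log_ω(x)² ∈ ℚ_p` with
`z ∈ H¹(ℤ[1/p],V) = ℚ_p·κ(x)`, `γ⁺` a `ℤ_p`-basis of `T(−1)⁺`, for ANY member. Hypothesis schema;
nothing asserted; every input printed.
[cite: Kato2004Asterisque, (14.9.3) (p. 240), §14.14 (p. 243), Prop. 14.16 (p. 244)]
[cite: BurnsKuriharaSano2019, Hyp. 2.2 (i) and Remark 2.3 (p. 9), Thm. 7.3 (p. 29), Thm. 7.8 (d) (p. 30)]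
[cite: CoatesLNM1716, Lemma 3.6 with proof (pp. 32–33) and Lemma 3.8 (p. 34)] [cite: GreenbergLNM1716, §3 after Lemma 3.3]
[cite: Kim2022StructureSelmer, §3.2.3 display before Thm. 3.7 (PDF p. 16)] -/
def RankOneCountReading : Prop :=
  ∀ (W : WeierstrassCurve ℚ) [W.IsElliptic] [W.IsGloballyMinimal] (p : ℕ) [Fact p.Prime]
    (D : KatoDescentDatum p) (ℒ : ℚ_[p]),
    W.analyticRank = 1 → p ≠ 2 → Addv W p → 0 ≤ padicValRat p W.j → ¬ p ∣ W.torsionOrder →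
    Finite W.sha → IsOf W p D → PRRatio W p ℒ →
    Finite (coinvariants p D.H2) ∧ (ℒ ≠ 0 ↔ D.zetaIndex ≠ 0) ∧
      ∀ m : ℕ, D.zetaIndex = p ^ m * D.h2Card →
        ℒ.valuation = (m : ℤ) +
          padicValNat p (Nat.card (AddCommGroup.primaryComponent W.sha p)) +
          padicValNat p W.tamagawaProduct

/-- **READING 4♭ — the Perrin-Riou ratio EXISTS in analytic rank one at a torsion-free member,
image-free**: `z ∈ H¹(ℤ[1/p],V) = ℚ_p ⊗ E(ℚ) = ℚ_p·κ(x)` (Thm. 14.5 (1)–(2): rank one; BKS display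
(h1) p. 9) and `log_ω(x) ≠ 0`, so `ℒ = log_ω(loc_p z)/log_ω(x)²` is defined — no integrality and no
image hypothesis needed. Hypothesis schema over the interface; nothing asserted.
[cite: Kato2004Asterisque, Thm. 14.5 (1)–(2) (p. 236)] [cite: BurnsKuriharaSano2019, display (h1) and Remark 2.3 (p. 9), Thm. 1.4 (p. 4)] -/
def HasPRRatio : Prop :=
  ∀ (W : WeierstrassCurve ℚ) [W.IsElliptic] [W.IsGloballyMinimal] (p : ℕ) [Fact p.Prime],
    W.analyticRank = 1 → p ≠ 2 → Addv W p → 0 ≤ padicValRat p W.j → ¬ p ∣ W.torsionOrder →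
    ∃ ℒ : ℚ_[p], PRRatio W p ℒ

/-- **READING 3♭ — at a torsion-free member a Kato descent datum is REALISED, granted the integrality
clause of Conj. 12.10.** `KMC W p` (Kato's Conj. 12.10 for `T_pW` on the `Δ`-trivial component, the
meaning fixed by part 1's interface lemma `ReadsTrivialKMC`) asserts in particular
`Z(f,T)_𝔮 ⊂ 𝐇¹(T)_𝔮` at every height-one `𝔮` (Kato p. 224), i.e. `(z_γ)⁰` lies in the reflexive hull
of `𝐇¹(T)⁰` (torsion-free of rank one, Thm. 12.4 (2); hull = ∩ of the height-one localisations,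
Bourbaki AC VII §4 no. 2); when `p ∤ #W(ℚ)_tors` the module `𝐇¹(T)⁰` is FREE (its coinvariants
`𝐇¹(T)⁰/T ↪ H¹(ℤ[1/p],T)` by (14.14.1) are `ℤ_p`-torsion-free, the torsion of `H¹(ℤ[1/p], j_*T)`
injecting into `W(ℚ)[p^∞] = 0`; freeness criterion for finitely generated torsion-free modules over the
regular local ring `ℤ_p⟦T⟧`), hence equal to its hull: `(z_γ)⁰ ∈ 𝐇¹(T)⁰`, and Kato's §14.14 data
(`𝐇¹(T)⁰`, `(z_γ)⁰ ≠ 0` with torsion quotient (12.4 (2), 12.5 (2)), `𝐇²(T)⁰` torsion (12.4 (1)),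
`A = H¹(ℤ[1/p],T)`, (14.14.1) "by the argument as in 13.8" — image-free: `H⁰(ℚ,T) = 0`, `cd_p = 2`)
form a `KatoDescentDatum p` of `W`. = part 1's `Realizable` with (12.5.2) (there: Thm. 12.5 (4) for
integrality) REPLACED by `p ∤ #tors` + the integrality clause of `KMC W p`. NOTE (planner g6 (δ)):
this schema reads the interface `KMC` as Conj. 12.10 WITH its printed integrality clause ("KMC⁺");
part 1's `ReadsTrivialKMC` exercises only the length clause (on realised data the integrality is built
into the datum) — consumers display BOTH schemata by name, so the stronger reading is never hidden.
Hypothesis schema; nothing asserted. [cite: Kato2004Asterisque, Conj. 12.10 (p. 224), Thm. 12.4 (p. 221), Thm. 12.5 (2) (p. 221), 8.2 (pp. 180–181), 13.8 (pp. 227–228), §14.14 (14.14.1) (p. 243)]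
[cite: BourbakiAC5to7, Ch. VII §4 no. 2] -/
def RealizableOfKMC : Prop :=
  ∀ (W : WeierstrassCurve ℚ) [W.IsElliptic] [W.IsGloballyMinimal] (p : ℕ) [Fact p.Prime],
    p ≠ 2 → Addv W p → 0 ≤ padicValRat p W.j → ¬ p ∣ W.torsionOrder → KMC W p →
    ∃ D : KatoDescentDatum p, IsOf W p D

end Readings

/-! ## §2 Consistency: on the (12.5.2) rows the image-free schemata are IMPLIED by parts 1/3/5's -/

section Consistency

variable {IsOf : ∀ (W : WeierstrassCurve ℚ) [W.IsElliptic] [W.IsGloballyMinimal] (p : ℕ) [Fact p.Prime],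
  KatoDescentDatum p → Prop}
variable {PRRatio : ∀ (W : WeierstrassCurve ℚ) [W.IsElliptic] [W.IsGloballyMinimal] (p : ℕ)
  [Fact p.Prime], ℚ_[p] → Prop}
variable {KMC : ∀ (W : WeierstrassCurve ℚ) [W.IsElliptic] [W.IsGloballyMinimal] (p : ℕ), Prop}

/-- Under (12.5.2), `p ∤ #W(ℚ)_tors` (`E[p]` irreducible; Mazur III.5 bookkeeping of the tree).
[cite: Kato2004Asterisque, (12.5.2) (p. 222)] [cite: Mazur1977, Ch. III §5, p. 157] -/
theorem not_dvd_torsionOrder_of_imageContainsSL2 (W : WeierstrassCurve ℚ) [W.IsElliptic]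
    (p : ℕ) [Fact p.Prime] (hK : Kato2004.ImageContainsSL2 W p) : ¬ p ∣ W.torsionOrder := by
  intro h
  have h0 : padicValNat p W.torsionOrder = 0 :=
    padicValNat_torsionOrder_eq_zero_of_irreducible W p (irr_of_imageContainsSL2 W p hK)
  have h1 : 1 ≤ padicValNat p W.torsionOrder :=
    (padicValNat_dvd_iff_le W.torsionOrder_pos_holds.ne').mp (by simpa using h)
  omega

/-- **Part 1's Reading 1 implies Reading 1♭'s conclusion on the (12.5.2) rows** (`[A : z] = p^m·#H²`
gives `v_p[A : z] = m + v_p #H²`): the new schema is the `m`-free rewrite of the old one.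
[cite: Kato2004Asterisque, Prop. 14.16 (2) (p. 244), Thm. 14.5 (3) (p. 236)] -/
theorem descentCount_of_descentCountReading (hR : Additive.DescentCountReading IsOf)
    (W : WeierstrassCurve ℚ) [W.IsElliptic] [W.IsGloballyMinimal] (p : ℕ) [Fact p.Prime]
    (D : KatoDescentDatum p) (hp : p ≠ 2) (hadd : Addv W p) (hj : 0 ≤ padicValRat p W.j)
    (hK : Kato2004.ImageContainsSL2 W p) (hL : W.entireLFunction 1 ≠ 0) (hfin : Finite W.sha)
    (hDof : IsOf W p D) :
    Finite (coinvariants p D.H2) ∧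
      ∃ q : ℚ, W.entireLFunction 1 / (W.realPeriodRat : ℂ) = (q : ℂ) ∧
        (padicValNat p (Nat.card (AddCommGroup.primaryComponent W.sha p)) : ℤ) +
            padicValNat p W.tamagawaProduct + padicValNat p D.zetaIndex =
          padicValRat p q + padicValNat p D.h2Card := by
  obtain ⟨hfinH2, q, m, hq, hidx, hcount⟩ := hR W p D hp hadd hj hK hL hfin hDof
  refine ⟨hfinH2, q, hq, ?_⟩
  have hpos : D.h2Card ≠ 0 := (D.h2Card_pos hfinH2).ne'
  have hv : padicValNat p D.zetaIndex = m + padicValNat p D.h2Card := by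
    rw [hidx, padicValNat.mul (pow_ne_zero m (Fact.out : p.Prime).ne_zero) hpos, padicValNat.prime_pow]
  rw [hv, Nat.cast_add]
  linarith

/-- **Part 5's Reading 1″ implies Reading 1″♭'s conclusion on the (12.5.2) rows** (same statement,
stronger binder). [cite: BurnsKuriharaSano2019, Thm. 7.3 (p. 29)] [cite: Kato2004Asterisque, §14.14 (p. 243)] -/
theorem rankOneCount_of_rankOneCountReading (hC : Additive.RankOneCountReading IsOf PRRatio)
    (W : WeierstrassCurve ℚ) [W.IsElliptic] [W.IsGloballyMinimal] (p : ℕ) [Fact p.Prime]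
    (D : KatoDescentDatum p) (ℒ : ℚ_[p]) (hr : W.analyticRank = 1) (hp : p ≠ 2) (hadd : Addv W p)
    (hj : 0 ≤ padicValRat p W.j) (hK : Kato2004.ImageContainsSL2 W p) (hfin : Finite W.sha)
    (hDof : IsOf W p D) (hℒ : PRRatio W p ℒ) :
    Finite (coinvariants p D.H2) ∧ (ℒ ≠ 0 ↔ D.zetaIndex ≠ 0) ∧
      ∀ m : ℕ, D.zetaIndex = p ^ m * D.h2Card →
        ℒ.valuation = (m : ℤ) +
          padicValNat p (Nat.card (AddCommGroup.primaryComponent W.sha p)) +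
          padicValNat p W.tamagawaProduct :=
  hC W p D ℒ hr hp hadd hj hK hfin hDof hℒ

/-- **Part 1's Reading 3 implies Reading 3♭'s conclusion on the (12.5.2) rows** (there the datum exists
outright, by Thm. 12.5 (4)). [cite: Kato2004Asterisque, Thm. 12.5 (4) (p. 222), §14.14 (p. 243)] -/
theorem realizable_of_realizable (hreal : Additive.Realizable IsOf)
    (W : WeierstrassCurve ℚ) [W.IsElliptic] [W.IsGloballyMinimal] (p : ℕ) [Fact p.Prime]
    (hp : p ≠ 2) (hadd : Addv W p) (hj : 0 ≤ padicValRat p W.j)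
    (hK : Kato2004.ImageContainsSL2 W p) : ∃ D : KatoDescentDatum p, IsOf W p D :=
  hreal W p hp hadd hj hK

end Consistency

/-! ## §3 Bookkeeping `L^{(r)}(W,1)/(r!·Ω·Reg) ↔ #Ш_an` with `p ∤ #W(ℚ)_tors` as the hypothesis -/

section Bookkeeping

variable (W : WeierstrassCurve ℚ) [W.IsElliptic] (p : ℕ) [Fact p.Prime]

omit [W.IsElliptic] [Fact p.Prime] in
/-- `v_p(#tors) = 0` from `p ∤ #tors`. [folklore] -/
theorem padicValNat_torsionOrder_eq_zero (ht : ¬ p ∣ W.torsionOrder) :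
    padicValNat p W.torsionOrder = 0 :=
  padicValNat.eq_zero_of_not_dvd ht

/-- **Rank `0`: from `L(E,1)/Ω = q` and `ord_p #Ш(p) + v_p(Tam) + a = ord_p q + b` to `#Ш_an = q'`
with `ord_p #Ш_an = ord_p #Ш + a − b`** (`p ∤ #tors`; `Reg = 1`). Bookkeeping.
[cite: Miller2011LMS, Def. 1.1 (arXiv:1010.2431 p. 3)] -/
theorem exists_shaAn_eq_of_count (hGZK : rank_eq_analyticRank_of_analyticRank_le_one)
    (hr : W.analyticRank = 0) (hL : W.entireLFunction 1 ≠ 0) (ht : ¬ p ∣ W.torsionOrder)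
    {q : ℚ} {a b : ℕ} (hq : W.entireLFunction 1 / (W.realPeriodRat : ℂ) = (q : ℂ))
    (hcount : (padicValNat p (Nat.card (AddCommGroup.primaryComponent W.sha p)) : ℤ) +
      padicValNat p W.tamagawaProduct + a = padicValRat p q + b) :
    ∃ q' : ℚ, shaAn W = (q' : ℂ) ∧
      padicValRat p q' = (padicValNat p W.shaOrder : ℤ) + a - b := by
  obtain ⟨hmw, hfin⟩ := hGZK W (by rw [hr]; exact zero_le_one)
  haveI : Finite W.sha := hfin
  have hmw0 : W.mordellWeilRank = 0 := by rw [hmw, hr]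
  have hΩpos : 0 < W.realPeriodRat := W.realPeriodRat_pos_holds
  have hΩ : (W.realPeriodRat : ℂ) ≠ 0 := by exact_mod_cast hΩpos.ne'
  have hc0 : 0 < W.tamagawaProduct := W.tamagawaProduct_pos_holds
  have ht0 : 0 < W.torsionOrder := W.torsionOrder_pos_holds
  have hq0 : q ≠ 0 := by
    rintro rfl
    rw [Rat.cast_zero, div_eq_zero_iff] at hq
    exact hq.elim hL hΩ
  refine ⟨q * (W.torsionOrder : ℚ) ^ 2 / (W.tamagawaProduct : ℚ), ?_, ?_⟩
  · have hLq : W.entireLFunction 1 = (q : ℂ) * (W.realPeriodRat : ℂ) := by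
      rw [← hq, div_mul_cancel₀ _ hΩ]
    rw [shaAn_def, leadingLCoeff_eq_of_analyticRank_eq_zero W hr,
      W.regulator_eq_one_of_rank_zero hmw0, hLq]
    push_cast
    field_simp
  · have htq : (W.torsionOrder : ℚ) ≠ 0 := by exact_mod_cast ht0.ne'
    have hcq : (W.tamagawaProduct : ℚ) ≠ 0 := by exact_mod_cast hc0.ne'
    have hsha : padicValNat p (Nat.card (AddCommGroup.primaryComponent W.sha p)) =
        padicValNat p W.shaOrder := by
      unfold WeierstrassCurve.shaOrder
      exact padicValNat_card_addPrimaryComponent p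
    have htors : padicValNat p W.torsionOrder = 0 := padicValNat_torsionOrder_eq_zero W p ht
    have hv : padicValRat p (q * (W.torsionOrder : ℚ) ^ 2 / (W.tamagawaProduct : ℚ)) =
        padicValRat p q + 2 * (padicValNat p W.torsionOrder : ℤ) -
          (padicValNat p W.tamagawaProduct : ℤ) := by
      rw [padicValRat.div (mul_ne_zero hq0 (pow_ne_zero 2 htq)) hcq,
        padicValRat.mul hq0 (pow_ne_zero 2 htq), pow_two, padicValRat.mul htq htq,
        padicValRat.of_nat, padicValRat.of_nat]
      ring
    rw [hv, htors, ← hsha]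
    simp only [Nat.cast_zero, mul_zero, add_zero]
    linarith

/-- **Rank `≤ 1`: from `L^{(r)}(W,1)/(r!·Ω·Reg) = q` to `#Ш_an = q·#tors²/Tam` with
`ord_p #Ш_an = ord_p q − ord_p Tam`** (`p ∤ #tors`; `q ≠ 0` as the leading coefficient is non-zero).
Bookkeeping. [cite: Miller2011LMS, Def. 1.1 (arXiv:1010.2431 p. 3)] -/
theorem exists_shaAn_eq_of_leadingTerm_eq (ht : ¬ p ∣ W.torsionOrder) (hL : W.leadingLCoeff ≠ 0)
    {q : ℚ} (hq : W.leadingLCoeff / ((W.realPeriodRat : ℂ) * (W.regulator : ℂ)) = (q : ℂ)) :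
    ∃ q' : ℚ, shaAn W = (q' : ℂ) ∧
      padicValRat p q' = padicValRat p q - padicValNat p W.tamagawaProduct := by
  have hΩ : (W.realPeriodRat : ℂ) ≠ 0 := by exact_mod_cast W.realPeriodRat_pos_holds.ne'
  have hR : (W.regulator : ℂ) ≠ 0 := by exact_mod_cast W.regulator_pos'.ne'
  have hc0 : 0 < W.tamagawaProduct := W.tamagawaProduct_pos_holds
  have ht0 : 0 < W.torsionOrder := W.torsionOrder_pos_holds
  have hq0 : q ≠ 0 := by
    rintro rfl
    rw [Rat.cast_zero, div_eq_zero_iff] at hq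
    exact hq.elim hL (mul_ne_zero hΩ hR)
  refine ⟨q * (W.torsionOrder : ℚ) ^ 2 / (W.tamagawaProduct : ℚ), ?_, ?_⟩
  · have hLq : W.leadingLCoeff = (q : ℂ) * ((W.realPeriodRat : ℂ) * (W.regulator : ℂ)) := by
      rw [← hq, div_mul_cancel₀ _ (mul_ne_zero hΩ hR)]
    rw [shaAn_def, hLq]
    push_cast
    field_simp
  · have htq : (W.torsionOrder : ℚ) ≠ 0 := by exact_mod_cast ht0.ne'
    have hcq : (W.tamagawaProduct : ℚ) ≠ 0 := by exact_mod_cast hc0.ne'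
    have htors : padicValNat p W.torsionOrder = 0 := padicValNat_torsionOrder_eq_zero W p ht
    rw [padicValRat.div (mul_ne_zero hq0 (pow_ne_zero 2 htq)) hcq,
      padicValRat.mul hq0 (pow_ne_zero 2 htq), pow_two, padicValRat.mul htq htq,
      padicValRat.of_nat, padicValRat.of_nat, htors]
    push_cast
    ring

/-- **Conversely, from `#Ш_an = q'` to `L^{(r)}(W,1)/(r!·Ω·Reg) = q'·Tam/#tors²` with
`ord_p = ord_p q' + ord_p Tam`** (`p ∤ #tors`). Bookkeeping. [cite: Miller2011LMS, Def. 1.1 (arXiv:1010.2431 p. 3)] -/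
theorem exists_leadingTerm_eq_of_shaAn_eq (ht : ¬ p ∣ W.torsionOrder) (hL : W.leadingLCoeff ≠ 0)
    {q' : ℚ} (hq' : shaAn W = (q' : ℂ)) :
    ∃ q : ℚ, W.leadingLCoeff / ((W.realPeriodRat : ℂ) * (W.regulator : ℂ)) = (q : ℂ) ∧
      padicValRat p q = padicValRat p q' + padicValNat p W.tamagawaProduct := by
  have hΩ : (W.realPeriodRat : ℂ) ≠ 0 := by exact_mod_cast W.realPeriodRat_pos_holds.ne'
  have hR : (W.regulator : ℂ) ≠ 0 := by exact_mod_cast W.regulator_pos'.ne'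
  have hc0 : 0 < W.tamagawaProduct := W.tamagawaProduct_pos_holds
  have ht0 : 0 < W.torsionOrder := W.torsionOrder_pos_holds
  have hcC : (W.tamagawaProduct : ℂ) ≠ 0 := by exact_mod_cast hc0.ne'
  have htC : (W.torsionOrder : ℂ) ≠ 0 := by exact_mod_cast ht0.ne'
  have hq0 : q' ≠ 0 := by
    rintro rfl
    rw [Rat.cast_zero, shaAn_def, div_eq_zero_iff] at hq'
    rcases hq' with h | h
    · exact (mul_ne_zero hL (pow_ne_zero 2 htC)) h
    · exact (mul_ne_zero (mul_ne_zero hΩ hcC) hR) h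
  refine ⟨q' * (W.tamagawaProduct : ℚ) / (W.torsionOrder : ℚ) ^ 2, ?_, ?_⟩
  · rw [shaAn_def, div_eq_iff (mul_ne_zero (mul_ne_zero hΩ hcC) hR)] at hq'
    rw [div_eq_iff (mul_ne_zero hΩ hR)]
    have key : W.leadingLCoeff * (W.torsionOrder : ℂ) ^ 2 =
        ((q' * (W.tamagawaProduct : ℚ) / (W.torsionOrder : ℚ) ^ 2 : ℚ) : ℂ) *
          ((W.realPeriodRat : ℂ) * (W.regulator : ℂ)) * (W.torsionOrder : ℂ) ^ 2 := by
      rw [hq']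
      push_cast
      field_simp
    exact mul_right_cancel₀ (pow_ne_zero 2 htC) key
  · have htq : (W.torsionOrder : ℚ) ≠ 0 := by exact_mod_cast ht0.ne'
    have hcq : (W.tamagawaProduct : ℚ) ≠ 0 := by exact_mod_cast hc0.ne'
    have htors : padicValNat p W.torsionOrder = 0 := padicValNat_torsionOrder_eq_zero W p ht
    rw [padicValRat.div (mul_ne_zero hq0 hcq) (pow_ne_zero 2 htq), padicValRat.mul hq0 hcq,
      pow_two, padicValRat.mul htq htq, padicValRat.of_nat, padicValRat.of_nat, htors]
    push_cast
    ring

end Bookkeeping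

end TorsionFree

end Summit.BirchSwinnertonDyer.Rank1Residual.Additive

end
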